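import Summits.BirchSwinnertonDyer.BirchSwinnertonDyer.Theorems.PublishedInputsGreenbergLayerFormalKummer
import Summits.BirchSwinnertonDyer.BirchSwinnertonDyer.Theorems.PublishedInputsGreenbergLayerHTwoCount
import Summits.BirchSwinnertonDyer.BirchSwinnertonDyer.Theorems.PublishedInputsGreenbergLayerEulerPoincare
import Summits.BirchSwinnertonDyer.BirchSwinnertonDyer.Theorems.PublishedInputsGreenbergLemma34FormalCount
import Literature.NumberTheory.EllipticCurves.AnticyclotomicSignedLocalConditions
import HarnessLib

set_option linter.dupNamespace false -- `…BirchSwinnertonDyer.BirchSwinnertonDyer…` is the cell's nested layout (D-0017)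
set_option autoImplicit false

/-!
# Greenberg LNM 1716 Lemma 3.4 at the layers `n ≥ 1`, brick 7: the EXACT formal-group count over `ℚ` at `v ∣ p` at the
# LAYER `n`, `#(Ê(𝔪̄)^{H_∞}/(g^{pⁿ} − 1))[p^k] = #(Ê[p^k])^τ` (Kummer EXACT + Tate EPC over `H_n` + Lutz at the layer + `H²`)

Seat `bsd-inputs-k4-p1` (gen 6; LADDER-BSD D-0154 KEY (147)(f) «prove the printed input», row 1 K4 INPUTS; Greenberg
1999), `--supports stmt-BirchSwinnertonDyer-20309`. THEOREMS ONLY (no definition, no named fact, no `sorry`).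

R. Greenberg, LNM 1716 (1999), §2 Prop. 2.5 (p. 80) at the completed layer `(F_n)_{v_n}`: `Im λ / Im κ ≅ Ẽ(f_{v_n})_p`, the
factor `|ker(a_{v_n})|` of Lemma 3.4 (p. 89); over `ℚ`, `f_{v_n} = 𝔽_p` at every layer. Cell bsd-2adic's
`GoodOrdTower.natCard_torsionBy_coinv_formal_le_of_localEP` is the layer-`n` INEQUALITY `#(M₁/D₁M₁)[p^k] ≤ #SF`; gen 5's
`InputsGreenbergLemma34.natCard_torsionBy_coinv_formal_eq` the layer-`0` EQUALITY. Here every link of the layer-`n` chain is an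
equality: Kummer EXACT over `H_n` (brick 5), Tate's Euler–Poincaré formula over `H_n` with the exact constant
`#(ℤ_p / (p^k)^{pⁿ})` (brick 1, `[Γ : H_n] = pⁿ`), Lutz at the layer (`#(A_n/p^k) = p^{k pⁿ} · #A_n[p^k]`, cell bsd-2adic),
and `#H²(H_n, Ê[p^k]) = #(Ê[p^k])^τ` (brick 6); the factors `p^{k pⁿ} · #A_n[p^k]` cancel:

* `natCard_torsionBy_coinv_formal_eq_layer` — `#(M₁/D₁M₁)[p^k] = #{c ∈ Ê[p^k] : τ c = c}` for every `n`, `k`, with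
  `D₁ = g^{pⁿ} − 1` for a topological generator `g` of the localised `ℤ_p`-extension `κ_v = κ ∘ res_v`
  (`ZpExtension.localize`, available since `κ ∘ res_v` is onto at `v ∣ p`, hypothesis `hns`).

HONEST FRAMING: a local TOOL theorem with displayed hypotheses; closes nothing; no summit statement is proved; BSD is
not proved by any of this.

References: [GreenbergLNM1716] §2 Props. 2.2, 2.5 (pp. 73–80), §3 Lemma 3.4 (p. 89); [MilneADT2006] I Thm. 2.8, Cor. 2.3;
[SerreLocalFields1979] XIII §1.
-/

noncomputable section

open scoped Classical NNReal

namespace Summit.BirchSwinnertonDyer.BirchSwinnertonDyer.Theorems.InputsGreenbergLemma34Layer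

open CategoryTheory NumberField IsDedekindDomain Field
  Literature.NumberTheory.GaloisRepresentations Literature.NumberTheory.GaloisRepresentations.DiscreteGaloisModule
  IsDedekindDomain.HeightOneSpectrum Literature.NumberTheory.EllipticCurves.FormalGroupChart
  _root_.TopRep _root_.ContRepresentation _root_.ContinuousCohomology WeierstrassCurve
  Summit.BirchSwinnertonDyer.BirchSwinnertonDyer.Theorems.GoodOrdTower
  Summit.BirchSwinnertonDyer.BirchSwinnertonDyer.Theorems.InputsGreenbergLemma34
open Literature.NumberTheory.EllipticCurves hiding subgroupIncl

variable {p : ℕ} [hp : Fact p.Prime] {κ : ZpExtension ℚ p}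

/-- `#(𝒪[ℚ_v] ⧸ m) = #(ℤ_v ⧸ m)` for `m : ℕ`, the two valuation rings having the same elements (copy of the private helper
of cell bsd-2adic's `…GoodOrdTowerControlLayerFormalP` / gen 5's `…Lemma34FormalCount`). [folklore] -/
private theorem natCard_integer_quotient_natCast_eq₄ (v : HeightOneSpectrum (𝓞 ℚ)) (m : ℕ) :
    Nat.card ((ValuativeRel.valuation (v.adicCompletion ℚ)).integer ⧸
        Ideal.span {((m : ℕ) : (ValuativeRel.valuation (v.adicCompletion ℚ)).integer)}) =
      Nat.card (Valued.integer (v.adicCompletion ℚ) ⧸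
        Ideal.span {((m : ℕ) : Valued.integer (v.adicCompletion ℚ))}) := by
  have hO : (ValuativeRel.valuation (v.adicCompletion ℚ)).integer = Valued.integer (v.adicCompletion ℚ) := by
    ext x
    rw [Valuation.mem_integer_iff, adicCompletion_valuation_le_one_iff ℚ v x,
      Valuation.mem_integer_iff, Valued.toNormedField.norm_le_one_iff]
  let e : (ValuativeRel.valuation (v.adicCompletion ℚ)).integer ≃+* Valued.integer (v.adicCompletion ℚ) :=
    RingEquiv.subringCongr hO
  have hIJ : Ideal.span {((m : ℕ) : Valued.integer (v.adicCompletion ℚ))} =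
      (Ideal.span {((m : ℕ) : (ValuativeRel.valuation (v.adicCompletion ℚ)).integer)}).map
        (e : (ValuativeRel.valuation (v.adicCompletion ℚ)).integer →+* _) := by
    rw [Ideal.map_span, Set.image_singleton, map_natCast]
  exact Nat.card_congr (Ideal.quotientEquiv _ _ e hIJ).toEquiv

set_option maxHeartbeats 3200000 in
/-- **The EXACT formal-group count at the layer `n`: `#(M₁/D₁M₁)[p^k] = #{c ∈ Ê[p^k] : τ c = c}`, `D₁ = g^{pⁿ} − 1`.**
Setting (the bsd-2adic bricks at the layer `n`, gen 5's at the layer `0`): `κ` the cyclotomic `ℤ_p`-extension of `ℚ`,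
`v ∣ p`, `K = ℚ_v`, `κ ∘ res_v` onto (`hns`) with topological generator `g` of the localised extension, `w` the spectral
valuation, `W/ℚ` with `W ⊗ K̄_v` integral and elliptic and `W ⊗ L_n` integral for the layer field `L_n = K̄_v^{H_n}`,
`red₀ : E(K̄_v) → B` with kernel the formal group (`hker`), `Γ`-stable (`hstab`), `p`-divisible (`hdiv₁`), ordinary
filtration (`hgenr`, `hsurj`), `τ ∈ H_∞` fixing `μ_{p^∞}` with the Hensel property, `M₁ = E₁ ∩ E(K̄_v)^{H_∞}`,
`D₁ = g^{pⁿ} − 1`, the Coates–Greenberg vanishing on `H_∞` (`hCG`), `C = E₁ ∩ E(K̄_v)[p^k]`. Then `(M₁/D₁M₁)[p^k]` is finite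
and `#(M₁/D₁M₁)[p^k] = #{c ∈ C : τ c = c}`. [cite: GreenbergLNM1716, §2 Prop. 2.5 (p. 80), §3 Lemma 3.4 (p. 89)]
[cite: MilneADT2006, I Thm. 2.8, Cor. 2.3] -/
theorem natCard_torsionBy_coinv_formal_eq_layer (hκ : κ.IsCyclotomic) (v : HeightOneSpectrum (𝓞 ℚ))
    (hv : ((p : ℕ) : 𝓞 ℚ) ∈ v.asIdeal)
    (W : WeierstrassCurve ℚ) [W.IsElliptic] (n k : ℕ)
    {w : Valuation (AlgebraicClosure (v.adicCompletion ℚ)) ℝ≥0}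
    (hw : ∀ x, (w x : ℝ) = spectralNorm (v.adicCompletion ℚ) (AlgebraicClosure (v.adicCompletion ℚ)) x)
    [hV : (W.baseChange (AlgebraicClosure (v.adicCompletion ℚ))).IsIntegral w.integer]
    [(W.baseChange (AlgebraicClosure (v.adicCompletion ℚ))).IsElliptic]
    [hVL : (W.baseChange (IntermediateField.fixedField
        (localSubgroup (κ.layerSubgroup n) (v.adicCompletion ℚ)) :
          IntermediateField (v.adicCompletion ℚ) (AlgebraicClosure (v.adicCompletion ℚ)))).IsIntegral
      (w.comap (algebraMap (IntermediateField.fixedField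
        (localSubgroup (κ.layerSubgroup n) (v.adicCompletion ℚ)) :
          IntermediateField (v.adicCompletion ℚ) (AlgebraicClosure (v.adicCompletion ℚ)))
        (AlgebraicClosure (v.adicCompletion ℚ)))).integer]
    {B : Type} [AddCommGroup B] (red₀ : localPoints W (v.adicCompletion ℚ) →+ B)
    (hker : ∀ Q : localPoints W (v.adicCompletion ℚ), red₀ Q = 0 ↔
      (Q : (W.baseChange (AlgebraicClosure (v.adicCompletion ℚ))).toAffine.Point) ∈
        kernel w (W.baseChange (AlgebraicClosure (v.adicCompletion ℚ))))
    (hstab : ∀ (σ : absoluteGaloisGroup (v.adicCompletion ℚ)) (Q : localPoints W (v.adicCompletion ℚ)),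
      red₀ Q = 0 → red₀ (σ • Q) = 0)
    (hdiv₁ : ∀ a : localPoints W (v.adicCompletion ℚ), red₀ a = 0 →
      ∃ b : localPoints W (v.adicCompletion ℚ), red₀ b = 0 ∧ p • b = a)
    (hgenr : ∀ r : ℕ, ∃ P₁ : localPoints W (v.adicCompletion ℚ), red₀ P₁ = 0 ∧ addOrderOf P₁ = p ^ r ∧
      ∀ P : localPoints W (v.adicCompletion ℚ), red₀ P = 0 → ((p ^ r : ℕ) : ℤ) • P = 0 → ∃ c : ℕ, P = c • P₁)
    (hsurj : ∀ (r : ℕ) (y : B), ((p ^ r : ℕ) : ℤ) • y = 0 →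
      ∃ x : localPoints W (v.adicCompletion ℚ), ((p ^ r : ℕ) : ℤ) • x = 0 ∧ red₀ x = y)
    {τ : absoluteGaloisGroup (v.adicCompletion ℚ)}
    (hτHi : τ ∈ localSubgroup κ.kerSubgroup (v.adicCompletion ℚ))
    (hτfix : ∀ (r : ℕ) (ξ : AlgebraicClosure (v.adicCompletion ℚ)), ξ ^ p ^ r = 1 → τ • ξ = ξ)
    (hHensel : ∀ Q : localPoints W (v.adicCompletion ℚ), red₀ (τ • Q) = red₀ Q →
      ∃ P₀ : localPoints W (v.adicCompletion ℚ),
        (∀ σ : absoluteGaloisGroup (v.adicCompletion ℚ), σ • P₀ = P₀) ∧ red₀ P₀ = red₀ Q)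
    (hns : Function.Surjective (κ.toContinuousMonoidHom.comp (resGal (K := ℚ) (v.adicCompletion ℚ))))
    {g : absoluteGaloisGroup (v.adicCompletion ℚ)}
    (hγ : (κ.localize (closureEmb (K := ℚ) (v.adicCompletion ℚ)) hns).IsTopGenerator g)
    (M₁ : AddSubgroup (localPoints W (v.adicCompletion ℚ)))
    (hM₁ : ∀ a, a ∈ M₁ ↔ a ∈ red₀.ker ∧ ∀ h ∈ localSubgroup κ.kerSubgroup (v.adicCompletion ℚ), h • a = a)
    (D₁ : M₁ →+ M₁) (hD₁ : ∀ a : M₁, ((D₁ a : M₁) : localPoints W (v.adicCompletion ℚ)) = (g ^ p ^ n) • (a : _) - a)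
    (hCG : ∀ ψ : contOneCocycles (discreteTopRep (localSubgroup κ.kerSubgroup (v.adicCompletion ℚ))
        (localPoints W (v.adicCompletion ℚ))),
      (∀ τ', red₀ (ψ.1 τ') = 0) →
        ∃ e : localPoints W (v.adicCompletion ℚ), red₀ e = 0 ∧
          ∀ τ' : localSubgroup κ.kerSubgroup (v.adicCompletion ℚ),
            ψ.1 τ' = (τ' : absoluteGaloisGroup (v.adicCompletion ℚ)) • e - e)
    (C : AddSubgroup (localPoints W (v.adicCompletion ℚ))) (hC : ∀ a, a ∈ C ↔ red₀ a = 0 ∧ p ^ k • a = 0) :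
    Finite {c : M₁ ⧸ D₁.range // p ^ k • c = 0} ∧
      Nat.card {c : M₁ ⧸ D₁.range // p ^ k • c = 0} =
        Nat.card {c : C // τ • (c : localPoints W (v.adicCompletion ℚ)) = c} := by
  -- adapted from …GoodOrdTowerControlLayerFormalP (cell bsd-2adic, layer n, ≤) and …Lemma34FormalCount (gen 5, n = 0, =)
  -- notation
  let K := v.adicCompletion ℚ
  let P : Type := localPoints W K
  let Γ := absoluteGaloisGroup K
  let Hn : Subgroup Γ := localSubgroup (κ.layerSubgroup n) K
  let Hi : Subgroup Γ := localSubgroup κ.kerSubgroup K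
  let κE : ZpExtension K p := κ.localize (closureEmb (K := ℚ) K) hns
  have hkerE : κE.kerSubgroup = Hi := rfl
  have hlayE : κE.layerSubgroup n = Hn := rfl
  haveI : CompactSpace Γ := absoluteGaloisGroup_compactSpace K
  -- NB: `CharZero ℚ_v` is never a local instance here (`Algebra ℚ ℚ_v` diamond): it is passed explicitly below
  have hkst : ∀ (σ : Γ) (a : P), a ∈ red₀.ker → σ • a ∈ red₀.ker :=
    fun σ a ha ↦ (AddMonoidHom.mem_ker).mpr (hstab σ a ((AddMonoidHom.mem_ker).mp ha))
  have hHile : Hi ≤ Hn := localSubgroup_ker_le_layer κ K n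
  have hopen : IsOpen (Hn : Set Γ) := MultTowerNS2.isOpen_localSubgroup _ (κ.isOpen_layerSubgroup n) K
  have hclosed : IsClosed (Hn : Set Γ) := Subgroup.isClosed_of_isOpen _ hopen
  haveI hHnN : Hn.Normal := by
    change (localSubgroup (κ.layerSubgroup n) K).Normal
    rw [localSubgroup_eq_comap]; exact Subgroup.Normal.comap inferInstance _
  haveI : CompactSpace Hn := isCompact_iff_compactSpace.mp hclosed.isCompact
  -- `Aₙ = A₁ ∩ E(K̄_v)^{H_n}`
  let Aₙ : AddSubgroup P := red₀.ker ⊓ FixedPoints.addSubgroup Hn P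
  have hAₙ : ∀ a, a ∈ Aₙ ↔ a ∈ red₀.ker ∧ ∀ σ ∈ Hn, σ • a = a := fun a ↦ by
    change a ∈ red₀.ker ⊓ FixedPoints.addSubgroup Hn P ↔ _
    rw [AddSubgroup.mem_inf, FixedPoints.mem_addSubgroup]
    exact ⟨fun ⟨h1, h2⟩ ↦ ⟨h1, fun σ hσ ↦ h2 ⟨σ, hσ⟩⟩, fun ⟨h1, h2⟩ ↦ ⟨h1, fun σ ↦ h2 σ σ.2⟩⟩
  -- iterated `p`-divisibility of `A₁`
  have hdivpow : ∀ (j : ℕ) (a : P), a ∈ red₀.ker → ∃ b ∈ red₀.ker, p ^ j • b = a := by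
    intro j
    induction j with
    | zero => exact fun a ha ↦ ⟨a, ha, by rw [pow_zero, one_smul]⟩
    | succ j ih =>
      intro a ha
      obtain ⟨b, hb, rfl⟩ := hdiv₁ a ((AddMonoidHom.mem_ker).mp ha)
      obtain ⟨c, hc, rfl⟩ := ih b ((AddMonoidHom.mem_ker).mpr hb)
      exact ⟨c, hc, by rw [pow_succ, mul_comm, mul_smul]⟩
  -- the torsion module `C = A₁[p^k]`, cyclic on `P_k`, with its Galois representation
  obtain ⟨Pk, hPk0, hPkord, hPkgen⟩ := hgenr k
  have hPk2 : p ^ k • Pk = 0 := by rw [← hPkord]; exact addOrderOf_nsmul_eq_zero Pk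
  have hZs : ∀ a : P, a ∈ C ↔ red₀ a = 0 ∧ p ^ k • a = 0 := hC
  have hPkZ : Pk ∈ C := (hZs Pk).mpr ⟨hPk0, hPk2⟩
  have hZmul : ∀ a ∈ C, ∃ c : ℕ, a = c • Pk := fun a ha ↦
    hPkgen a ((hZs a).mp ha).1 (by rw [natCast_zsmul]; exact ((hZs a).mp ha).2)
  have hZstab : ∀ (σ : Γ) (a : P), a ∈ C → σ • a ∈ C := fun σ a ha ↦
    (hZs _).mpr ⟨hstab σ a ((hZs a).mp ha).1, by rw [smul_comm, ((hZs a).mp ha).2, smul_zero]⟩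
  letI iSMul : SMul Γ C := ⟨fun σ z ↦ ⟨σ • (z : P), hZstab σ z z.2⟩⟩
  have hsmul : ∀ (σ : Γ) (z : C), ((σ • z : C) : P) = σ • (z : P) := fun _ _ ↦ rfl
  letI iMA : MulAction Γ C :=
    { one_smul := fun z ↦ Subtype.ext (by rw [hsmul, one_smul])
      mul_smul := fun σ σ' z ↦ Subtype.ext (by rw [hsmul, hsmul, hsmul, mul_smul]) }
  letI iDMA : DistribMulAction Γ C :=
    { smul_zero := fun σ ↦ Subtype.ext (by rw [hsmul, ZeroMemClass.coe_zero, smul_zero])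
      smul_add := fun σ z z' ↦ Subtype.ext (by
        rw [hsmul, AddMemClass.coe_add, AddMemClass.coe_add, hsmul, hsmul, smul_add]) }
  let ρC : ContinuousRep Γ ℤ C :=
    ContinuousRep.ofStabilizerMemNhdsOne (Representation.ofDistribMulAction ℤ Γ C) fun z ↦ by
      have hopen' : IsOpen ((fun σ : Γ ↦ σ • (z : P)) ⁻¹' {(z : P)}) :=
        (isOpen_discrete _).preimage (continuous_smul_localPoints W K (z : P))
      refine Filter.mem_of_superset (hopen'.mem_nhds (by simp)) fun σ hσ ↦ ?_
      exact Subtype.ext hσ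
  have hρC : ∀ (σ : Γ) (z : C), ((ρC σ z : C) : P) = σ • (z : P) := fun _ _ ↦ rfl
  let Pz : C := ⟨Pk, hPkZ⟩
  have hZgen : ∀ z : C, ∃ i : ℕ, z = i • Pz := fun z ↦ by
    obtain ⟨c, hc⟩ := hZmul z z.2
    exact ⟨c, Subtype.ext (by rw [AddSubmonoidClass.coe_nsmul]; exact hc)⟩
  have hPzord : addOrderOf Pz = p ^ k := by rw [← AddSubgroup.addOrderOf_coe Pz]; exact hPkord
  have hZcard : Nat.card C = p ^ k := by
    have h : (AddSubgroup.zmultiples Pz : AddSubgroup C) = ⊤ := by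
      rw [eq_top_iff]
      intro z _
      obtain ⟨i, hi⟩ := hZgen z
      exact hi ▸ AddSubgroup.nsmul_mem _ (AddSubgroup.mem_zmultiples Pz) i
    rw [← hPzord, ← Nat.card_zmultiples Pz, h, AddSubgroup.card_top]
  haveI hZfin : Finite C := Nat.finite_of_card_ne_zero (by rw [hZcard]; exact pow_ne_zero k hp.out.ne_zero)
  have hZ2k : ∀ z : C, p ^ k • z = 0 := fun z ↦ Subtype.ext (by
    rw [AddSubmonoidClass.coe_nsmul, ZeroMemClass.coe_zero]; exact ((hZs z).mp z.2).2)
  -- BRICK 1: Tate's Euler–Poincaré count of `C` over `H_n`, with the EXACT constant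
  have hZprim : IsPrimaryTorsion p C := fun z ↦ ⟨k, hZ2k z⟩
  obtain ⟨hf1, hf2, m, hmeq, hEPZ⟩ : Finite (continuousCohomology 1 (ρC.restrict (subgroupIncl Hn)).toTopRep) ∧
      Finite (continuousCohomology 2 (ρC.restrict (subgroupIncl Hn)).toTopRep) ∧
      ∃ m : ℕ, p ^ m = Nat.card C ^ Hn.index ∧
        Nat.card (continuousCohomology 1 (ρC.restrict (subgroupIncl Hn)).toTopRep) =
          Nat.card (ρC.restrict (subgroupIncl Hn)).toTopRep.ρ.invariants *
            Nat.card (continuousCohomology 2 (ρC.restrict (subgroupIncl Hn)).toTopRep) *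
            Nat.card ((ValuativeRel.valuation K).integer ⧸
              Ideal.span {((p ^ m : ℕ) : (ValuativeRel.valuation K).integer)}) := by
    haveI : CharZero K := charZero_of_injective_algebraMap (algebraMap ℚ K).injective
    exact natCard_one_restrict_eq_of_localEP K (localEulerPoincareCharacteristic_holds K) Hn hopen ρC hZprim
  haveI := hf1
  haveI := hf2
  -- `p^m = (p^k)^{pⁿ}`, `#(𝒪[ℚ_v] ⧸ p^m) = p^m`
  have hidx := MultTowerNS2.index_localSubgroup_layerSubgroup hκ v hv n
  rw [hZcard, hidx, ← pow_mul] at hmeq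
  have hOm : Nat.card ((ValuativeRel.valuation K).integer ⧸
      Ideal.span {((p ^ m : ℕ) : (ValuativeRel.valuation K).integer)}) = p ^ m := by
    rw [natCard_integer_quotient_natCast_eq₄ v (p ^ m)]
    have hT : ∀ v' : HeightOneSpectrum (𝓞 ℚ), ((p ^ m : ℕ) : 𝓞 ℚ) ∈ v'.asIdeal → v' ∈ ({v} : Finset _) := by
      intro v' hv'
      rw [Finset.mem_singleton]
      have hv'p : ((p : ℕ) : 𝓞 ℚ) ∈ v'.asIdeal := by
        rw [Nat.cast_pow] at hv'
        exact v'.isPrime.mem_of_pow_mem _ hv'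
      apply (Rat.HeightOneSpectrum.primesEquiv (R := 𝓞 ℚ)).injective
      exact Subtype.ext ((Rat.HeightOneSpectrum.primesEquiv_eq_of_natCast_mem v' hp.out hv'p).trans
        (Rat.HeightOneSpectrum.primesEquiv_eq_of_natCast_mem v hp.out hv).symm)
    have h := prod_natCard_integer_quotient_natCast (K := ℚ) (pow_ne_zero m hp.out.ne_zero) hT
    rw [Finset.prod_singleton, Module.finrank_self, pow_one] at h
    exact h
  rw [hOm] at hEPZ
  -- BRICK 6: `#H²(H_n, C) = #C^τ`
  have hH2 : Nat.card (continuousCohomology 2 (ρC.restrict (subgroupIncl Hn)).toTopRep) =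
      Nat.card {c : C // τ • (c : P) = c} :=
    (@natCard_H2_restrict_formalTorsion_eq_natCard_fixed ℚ _ W _ K _ _ _ _
      (charZero_of_injective_algebraMap (algebraMap ℚ K).injective) _ p _ B _ red₀ hstab hgenr hsurj τ hτfix hHensel
      k C hC ρC hρC Hn _ hopen (hHile hτHi)).2
  -- invariants of `C` over `H_n` = `Aₙ[p^k]`
  have hinv : Nat.card (ρC.restrict (subgroupIncl Hn)).toTopRep.ρ.invariants =
      Nat.card (nsmulAddMonoidHom (p ^ k) : Aₙ →+ Aₙ).ker := by
    refine Nat.card_congr ?_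
    exact
      { toFun := fun z ↦ ⟨⟨((z.1 : C) : P), (hAₙ _).mpr ⟨(AddMonoidHom.mem_ker).mpr ((hZs _).mp z.1.2).1,
            fun σ hσ ↦ by
              have h := z.2 ⟨σ, hσ⟩
              exact (congrArg (fun y : C ↦ (y : P)) h : _)⟩⟩,
          by
            rw [AddMonoidHom.mem_ker, nsmulAddMonoidHom_apply]
            exact Subtype.ext (by rw [AddSubmonoidClass.coe_nsmul, ZeroMemClass.coe_zero]; exact ((hZs _).mp z.1.2).2)⟩
        invFun := fun a ↦ ⟨⟨((a.1 : Aₙ) : P), (hZs _).mpr ⟨(AddMonoidHom.mem_ker).mp ((hAₙ _).mp a.1.2).1, by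
            have h := a.2
            rw [AddMonoidHom.mem_ker, nsmulAddMonoidHom_apply] at h
            have h' := congrArg (fun y : Aₙ ↦ (y : P)) h
            simpa only [AddSubmonoidClass.coe_nsmul, ZeroMemClass.coe_zero] using h'⟩⟩,
          fun σ ↦ Subtype.ext (((hAₙ _).mp a.1.2).2 σ σ.2)⟩
        left_inv := fun z ↦ Subtype.ext (Subtype.ext rfl)
        right_inv := fun a ↦ Subtype.ext (Subtype.ext rfl) }
  -- Lutz at depth `p^k` for `Aₙ` over the layer field (cell bsd-2adic)
  haveI := MultTowerNS2.finiteDimensional_fixedField_localSubgroup_layerSubgroup (κ := κ) v n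
  have hfr := MultTowerNS2.finrank_fixedField_localSubgroup_layerSubgroup hκ v hv n
  have hAH : ∀ Q : P, Q ∈ Aₙ ↔ (Q : (W.baseChange (AlgebraicClosure K)).toAffine.Point) ∈
      kernel w (W.baseChange (AlgebraicClosure K)) ∧ ∀ σ ∈ Hn, σ • Q = Q := fun Q ↦ by
    rw [hAₙ, AddMonoidHom.mem_ker, hker Q]
  obtain ⟨hfinq, hfinker, hLutz⟩ := natCard_quotient_nsmul_fixedKernel_eq (K := ℚ) (v := v) hw hv W Hn Aₙ hAH
  haveI := hfinq
  have hO2 : Nat.card (v.adicCompletionIntegers ℚ ⧸ Ideal.span {((p : ℕ) : v.adicCompletionIntegers ℚ)}) = p := by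
    have hϖ : Irreducible ((p : ℕ) : v.adicCompletionIntegers ℚ) := irreducible_natCast_adicCompletionIntegers_rat hv
    rw [← (IsDiscreteValuationRing.irreducible_iff_uniformizer _).mp hϖ]
    change Nat.card (IsLocalRing.ResidueField (v.adicCompletionIntegers ℚ)) = p
    rw [natCard_residueField_adicCompletionIntegers v, Rat.HeightOneSpectrum.primesEquiv_eq_of_natCast_mem v hp.out hv]
  have hfinj : ∀ j : ℕ, Finite (nsmulAddMonoidHom (p ^ j) : Aₙ →+ Aₙ).ker := by
    intro j
    obtain ⟨Pj, hPj0, hPjord, hPjgen⟩ := hgenr j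
    haveI : Finite (AddSubgroup.zmultiples Pj) := Nat.finite_of_card_ne_zero (by
      rw [Nat.card_zmultiples, hPjord]; exact pow_ne_zero j hp.out.ne_zero)
    refine Finite.of_injective (fun a : (nsmulAddMonoidHom (p ^ j) : Aₙ →+ Aₙ).ker ↦
      (⟨((a : Aₙ) : P), ?_⟩ : AddSubgroup.zmultiples Pj)) fun a b hab ↦ ?_
    · have ha := a.2
      rw [AddMonoidHom.mem_ker, nsmulAddMonoidHom_apply] at ha
      have ha' : p ^ j • ((a : Aₙ) : P) = 0 := by
        have h := congrArg (fun y : Aₙ ↦ (y : P)) ha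
        simpa only [AddSubmonoidClass.coe_nsmul, ZeroMemClass.coe_zero] using h
      obtain ⟨c, hc⟩ := hPjgen _ ((AddMonoidHom.mem_ker).mp ((hAₙ _).mp (a : Aₙ).2).1)
        (by rw [natCast_zsmul]; exact ha')
      rw [hc]
      exact AddSubgroup.nsmul_mem _ (AddSubgroup.mem_zmultiples Pj) c
    · exact Subtype.ext (Subtype.ext (congrArg (fun y : AddSubgroup.zmultiples Pj ↦ (y : P)) hab))
  obtain ⟨hfinqk, hE⟩ := natCard_quotient_nsmul_pow_eq (A := Aₙ) p _ hfinj hLutz k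
  rw [hO2, hfr] at hE
  -- `H¹(H_n, C)` in the currency of brick 5 (the discrete module `C`) is `H¹` of `ρC|_{H_n}`
  let X₁ : TopRep ℤ Hn := discreteTopRep Hn C
  let X₂ : TopRep ℤ Hn := (ρC.restrict (subgroupIncl Hn)).toTopRep
  let e : Hn ≃ₜ* Hn := ContinuousMulEquiv.refl Hn
  let φ : TopRep.res ((e.symm : Hn →ₜ* Hn) : Hn →* Hn) X₁ ⟶ X₂ := TopRep.ofHom ⟨ContinuousLinearMap.id ℤ C, fun _ ↦ rfl⟩
  let ψ : TopRep.res ((e : Hn →ₜ* Hn) : Hn →* Hn) X₂ ⟶ X₁ := TopRep.ofHom ⟨ContinuousLinearMap.id ℤ C, fun _ ↦ rfl⟩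
  have htr : Nat.card (discreteH1 Hn C) = Nat.card (continuousCohomology 1 X₂) :=
    natCard_continuousCohomology_eq_of_continuousMulEquiv e φ ψ (fun _ ↦ rfl) (fun _ ↦ rfl) 1
  haveI hfinH1 : Finite (discreteH1 Hn C) := finite_continuousCohomology_of_continuousMulEquiv e φ ψ (fun _ ↦ rfl) 1
  haveI : Finite (discreteH1 (κE.layerSubgroup n) C) := hfinH1
  -- BRICK 5: the EXACT Kummer count at depth `p^k` over `H_n`
  have hZr : ∀ a : P, a ∈ red₀.ker ∧ p ^ k • a = 0 ↔ a ∈ C.subtype.range := fun a ↦ by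
    rw [AddSubgroup.range_subtype, hZs, AddMonoidHom.mem_ker]
  have hM₁' : ∀ a, a ∈ M₁ ↔ a ∈ red₀.ker ∧ ∀ h ∈ κE.kerSubgroup, h • a = a := fun a ↦ by rw [hM₁, hkerE]
  have hAₙ' : ∀ a, a ∈ Aₙ ↔ a ∈ red₀.ker ∧ ∀ σ ∈ κE.layerSubgroup n, σ • a = a := fun a ↦ by rw [hAₙ, hlayE]
  have hCG' : ∀ ψ' : contOneCocycles (discreteTopRep κE.kerSubgroup P), (∀ τ', ψ'.1 τ' ∈ red₀.ker) →
      ∃ e' ∈ red₀.ker, ∀ τ' : κE.kerSubgroup, ψ'.1 τ' = (τ' : Γ) • e' - e' := by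
    intro ψ' hψ'
    obtain ⟨e', he0, he'⟩ := hCG ψ' (fun τ' ↦ (AddMonoidHom.mem_ker).mp (hψ' τ'))
    exact ⟨e', (AddMonoidHom.mem_ker).mpr he0, he'⟩
  obtain ⟨hfinT, -, hB⟩ : Finite {c : M₁ ⧸ D₁.range // p ^ k • c = 0} ∧
      Finite (Aₙ ⧸ (nsmulAddMonoidHom (p ^ k) : Aₙ →+ Aₙ).range) ∧
      Nat.card {c : M₁ ⧸ D₁.range // p ^ k • c = 0} *
          Nat.card (Aₙ ⧸ (nsmulAddMonoidHom (p ^ k) : Aₙ →+ Aₙ).range) = Nat.card (discreteH1 Hn C) := by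
    exact @natCard_torsionBy_coinv_mul_card_quotient_eq_card_H1_layer ℚ _ W K _
      (charZero_of_injective_algebraMap (algebraMap ℚ K).injective) _ p _ κE g hγ n k red₀.ker hkst
      (hdivpow k) C _ _ _ _ C.subtype Subtype.val_injective hZr (fun _ _ ↦ rfl) M₁ hM₁' D₁ hD₁ Aₙ hAₙ' hCG' _
  refine ⟨hfinT, ?_⟩
  -- combine (all equalities) and cancel `p^{k pⁿ} · #Aₙ[p^k]`
  rw [htr] at hB
  rw [hinv, hH2] at hEPZ
  haveI := hfinker
  haveI := hfinj k
  have hppos : 0 < p := hp.out.pos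
  have hX : 0 < (p ^ p ^ n) ^ k * Nat.card (nsmulAddMonoidHom (p ^ k) : Aₙ →+ Aₙ).ker :=
    Nat.mul_pos (by positivity) Nat.card_pos
  have hpm : p ^ m = (p ^ p ^ n) ^ k := by rw [hmeq, ← pow_mul, mul_comm]
  refine Nat.eq_of_mul_eq_mul_right hX ?_
  calc Nat.card {c : M₁ ⧸ D₁.range // p ^ k • c = 0} * ((p ^ p ^ n) ^ k * Nat.card (nsmulAddMonoidHom (p ^ k) : Aₙ →+ Aₙ).ker)
      = Nat.card {c : M₁ ⧸ D₁.range // p ^ k • c = 0} * Nat.card (Aₙ ⧸ (nsmulAddMonoidHom (p ^ k) : Aₙ →+ Aₙ).range) := by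
        rw [hE]
    _ = Nat.card (continuousCohomology 1 X₂) := hB
    _ = Nat.card (nsmulAddMonoidHom (p ^ k) : Aₙ →+ Aₙ).ker * Nat.card {c : C // τ • (c : P) = c} * p ^ m := hEPZ
    _ = Nat.card {c : C // τ • (c : P) = c} * ((p ^ p ^ n) ^ k * Nat.card (nsmulAddMonoidHom (p ^ k) : Aₙ →+ Aₙ).ker) := by
        rw [hpm]; ring

end Summit.BirchSwinnertonDyer.BirchSwinnertonDyer.Theorems.InputsGreenbergLemma34Layer

end
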